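import Summits.CriticalPhenomena.SAWScalingLimit.Theorems.SAWTotalPositivityBoundaryTP2Defs
import Summits.CriticalPhenomena.SAWScalingLimit.Theorems.SAWTotalPositivityBoundaryTP2Kernel
import Summits.CriticalPhenomena.SAWScalingLimit.Theorems.SAWTotalPositivityBoundaryTP2Symmetry
import Summits.CriticalPhenomena.SAWScalingLimit.Theorems.SAWTotalPositivityBoundaryTP2LadderRung
import Summits.CriticalPhenomena.SAWScalingLimit.Theorems.SAWTotalPositivityBoundaryTP2LadderKernelsInterior
import Summits.CriticalPhenomena.SAWScalingLimit.Theorems.EdgeOfPositivity.Negative.EdgeOfPositivityRectDomain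
import HarnessLib

/-!
# Crux `BoundaryTP2` (stmt-CriticalPhenomena-7115), line `Sketch`: three bottom sites and the top
site above the middle one on a ladder, crossing pairing vs nested pairing

Tool stub `stub_ladder_bbbt_over_nested` of the line's skeleton: on the ladder
`R_L = discreteDomainGraph (rectDomain L 1) 1` (sites `{0..L} × {0,1}`), for bottom sites
`(c₁,0), (c₂,0), (c₃,0)` with `c₁ < c₂ < c₃ ≤ L`, the top site `(c₂,1)` above the middle one, and
every fugacity `0 ≤ x ≤ 1/2`, the crossing pairing weighs at most the nested one:

  `Z((c₁,0),(c₃,0)) Z((c₂,0),(c₂,1)) ≤ Z((c₁,0),(c₂,1)) Z((c₂,0),(c₃,0))`,  `Z = pathKernel R_L x`.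

Proof. Write `P = 1 + x`, `M = 1 - x`, `E_k = Σ_{d<k} x^{2d+3}`, `c₂ = c₁ + u + 1`,
`c₃ = c₂ + m + 1`, `E₁ = E_{c₁}`, `E₂ = E_{c₂}`, `F₂ = E_{L-c₂}`, `F₃ = E_{L-c₃}`,
`a₁ = P + E₁`, `a'₁ = M - E₁`, `a₂ = P + E₂`, `a'₂ = M - E₂`, `b₂ = P + F₂`, `b'₂ = M - F₂`,
`b₃ = P + F₃`, `b'₃ = M - F₃`. The landed kernels (`stub_ladderKernels_interior`,
`stub_ladderRung`) have the rank-two real forms `X = Z((c₁,0),(c₂,1)) = x^{u+1}/2 (a₁b₂P^u - a'₁b'₂M^u)`,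
`S₁₃ = Z((c₁,0),(c₃,0)) = x^{u+m+2}/2 (a₁b₃P^{u+m+1} + a'₁b'₃M^{u+m+1})`,
`S₂₃ = Z((c₂,0),(c₃,0)) = x^{m+1}/2 (a₂b₃P^m + a'₂b'₃M^m)`, `R = Z((c₂,0),(c₂,1)) = x + E₂ + F₂`,
the rung exceeding its rank-two value `½(a₂b₂/P - a'₂b'₂/M)` by `δ = x E₂ F₂/(PM)`. Cauchy–Binet
with inner dimension two gives the exact residual identity (`overNest_real`, `ring`)
`4PM (X S₂₃ - S₁₃ R) = x^{u+m+2} (T₁ T₂ - 2x E₂ F₂ (a₁b₃P^{u+m+1} + a'₁b'₃M^{u+m+1}))` with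
`T₁ = a₁a'₂P^{u+1} - a'₁a₂M^{u+1}`, `T₂ = b₃b'₂P^{m+1} + b'₃b₂M^{m+1}`, so the claim is the residual
inequality `T₁ T₂ ≥ 2x E₂ F₂ (a₁b₃P^{u+m+1} + a'₁b'₃M^{u+m+1})` (`overNest_bracket`): `T₁ ≥ P^u h`
with the orientation function `h = a₁a'₂P - a'₁a₂M = 2x(1-x²) + 2(1-x²)E₁ - (2+2x²)E₂ - 2xE₁E₂`
(`M^u ≤ P^u`), `T₂ ≥ b₃b'₂P^{m+1}`, `a'₁b'₃M^{u+m+1} ≤ a₁b₃M³P^{u+m}`, and the scalar core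
(`overNest_core`) `h b'₂ P ≥ 2x E₂ F₂ a₁ (P + M³)` for `0 ≤ x ≤ 1/2`, `E_k (1-x²) ≤ x³`, which is
affine in `E₁` with nonnegative slope and at `E₁ = 0` reduces, after multiplication by `(1-x²)²`,
to `(1-3x²)(1-x-x²) ≥ 2x⁶` (`1/16 ≥ 1/32`). Assembly in `ℝ≥0∞`: `ENNReal.ofReal_mul`,
`ENNReal.ofReal_le_ofReal`.
-/

noncomputable section

namespace Summit.CriticalPhenomena.SAWScalingLimit.Theorems.BoundaryTP2

open Literature.Probability.LatticeModels Literature.Probability.RandomPlanarGeometry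
open Summit.CriticalPhenomena.SAWScalingLimit.Theorems.EdgeOfPositivity.Negative
open scoped ENNReal

/-! ## The excursion sums `E_k = Σ_{d<k} x^{2d+3}` -/

/-- `E_k ≥ 0` for `x ≥ 0`. [folklore] -/
private theorem overNest_E_nonneg {x : ℝ} (hx : 0 ≤ x) (k : ℕ) :
    0 ≤ ∑ d ∈ Finset.range k, x ^ (2 * d + 3) :=
  Finset.sum_nonneg fun _ _ => pow_nonneg hx _

/-- Geometric bound `E_k (1 - x²) ≤ x³` for `x ≥ 0` (telescoping:
`E_k (1 - x²) = x³ - x^{2k+3}`). [folklore] -/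
private theorem overNest_E_bound {x : ℝ} (hx : 0 ≤ x) (k : ℕ) :
    (∑ d ∈ Finset.range k, x ^ (2 * d + 3)) * (1 - x ^ 2) ≤ x ^ 3 := by
  -- adapted from `ladderCB_excursion_mul` (LadderMinorCB)
  have h : (∑ d ∈ Finset.range k, x ^ (2 * d + 3)) * (1 - x ^ 2) = x ^ 3 - x ^ (2 * k + 3) := by
    induction k with
    | zero => simp
    | succ k ih =>
      rw [Finset.sum_range_succ, add_mul, ih]
      ring
  linarith [pow_nonneg hx (2 * k + 3)]

/-- For `0 ≤ x ≤ 1/2`, `0 ≤ E` with `E (1-x²) ≤ x³` one has `E ≤ 1/6`. [folklore] -/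
private theorem overNest_le_sixth {x E : ℝ} (hx0 : 0 ≤ x) (hx : x ≤ 1 / 2) (hE : 0 ≤ E)
    (hEb : E * (1 - x ^ 2) ≤ x ^ 3) : E ≤ 1 / 6 := by
  -- adapted from `ladderCB_coef_nonneg` (LadderMinorCB)
  have hx2 : x ^ 2 ≤ (1 / 2) ^ 2 := pow_le_pow_left₀ hx0 hx 2
  have hx3 : x ^ 3 ≤ (1 / 2) ^ 3 := pow_le_pow_left₀ hx0 hx 3
  norm_num at hx2 hx3
  have h1 : E * (3 / 4) ≤ E * (1 - x ^ 2) := mul_le_mul_of_nonneg_left (by linarith) hE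
  linarith

/-- **Scalar core.** For `0 ≤ x ≤ 1/2`, `E₁, E₂, F₂ ≥ 0` with `E₂ (1-x²) ≤ x³`, `F₂ (1-x²) ≤ x³`:
`2x E₂ F₂ (1+x+E₁) ((1+x) + (1-x)³) ≤ h · (1-x-F₂) · (1+x)` with the orientation function
`h = (1+x+E₁)(1-x-E₂)(1+x) - (1-x-E₁)(1+x+E₂)(1-x) = 2x(1-x²) + 2(1-x²)E₁ - (2+2x²)E₂ - 2xE₁E₂`.
The difference is `(1+x)·G₀ + E₁·K₁`; `(1-x²)² G₀ ≥ 2x((1-3x²)(1-x-x²) - 2x⁶) ≥ 0` and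
`K₁ ≥ 4/9 - 1/18`. [folklore] -/
private theorem overNest_core {x E₁ E₂ F₂ : ℝ} (hx0 : 0 ≤ x) (hx : x ≤ 1 / 2) (hE₁ : 0 ≤ E₁)
    (hE₂ : 0 ≤ E₂) (hF₂ : 0 ≤ F₂) (hE₂b : E₂ * (1 - x ^ 2) ≤ x ^ 3)
    (hF₂b : F₂ * (1 - x ^ 2) ≤ x ^ 3) :
    2 * x * E₂ * F₂ * (1 + x + E₁) * ((1 + x) + (1 - x) ^ 3) ≤
      ((1 + x + E₁) * (1 - x - E₂) * (1 + x) - (1 - x - E₁) * (1 + x + E₂) * (1 - x)) *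
        (1 - x - F₂) * (1 + x) := by
  have hx2 : x ^ 2 ≤ (1 / 2) ^ 2 := pow_le_pow_left₀ hx0 hx 2
  have hx3 : x ^ 3 ≤ (1 / 2) ^ 3 := pow_le_pow_left₀ hx0 hx 3
  norm_num at hx2 hx3
  have hE₂' : E₂ ≤ 1 / 6 := overNest_le_sixth hx0 hx hE₂ hE₂b
  have hF₂' : F₂ ≤ 1 / 6 := overNest_le_sixth hx0 hx hF₂ hF₂b
  have hM : 0 ≤ 1 - x := by linarith
  have h1x2 : 0 < 1 - x ^ 2 := by linarith
  -- the factor `S = (1+x) + (1-x)³ ∈ [0, 2]`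
  have hS0 : 0 ≤ (1 + x) + (1 - x) ^ 3 := by
    have := pow_nonneg hM 3
    linarith
  have hS2 : (1 + x) + (1 - x) ^ 3 ≤ 2 := by
    have e : 2 - ((1 + x) + (1 - x) ^ 3) = x * (1 - x) * (2 - x) := by ring
    have : 0 ≤ x * (1 - x) * (2 - x) := mul_nonneg (mul_nonneg hx0 hM) (by linarith)
    linarith
  -- the `E₁ = 0` part `G₀ = h₀ b'₂ - 2x E₂ F₂ S`, `h₀ = 2x(1-x²) - (2+2x²)E₂`
  have hG0 : 0 ≤ (2 * x * (1 - x ^ 2) - (2 + 2 * x ^ 2) * E₂) * (1 - x - F₂) -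
      2 * x * E₂ * F₂ * ((1 + x) + (1 - x) ^ 3) := by
    have h0 : 2 * x * (1 - 3 * x ^ 2) ≤
        (2 * x * (1 - x ^ 2) - (2 + 2 * x ^ 2) * E₂) * (1 - x ^ 2) := by
      have e : (2 * x * (1 - x ^ 2) - (2 + 2 * x ^ 2) * E₂) * (1 - x ^ 2) =
          2 * x * (1 - 3 * x ^ 2) + (2 + 2 * x ^ 2) * (x ^ 3 - E₂ * (1 - x ^ 2)) := by ring
      rw [e]
      have : 0 ≤ (2 + 2 * x ^ 2) * (x ^ 3 - E₂ * (1 - x ^ 2)) :=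
        mul_nonneg (by positivity) (by linarith)
      linarith
    have hb : 1 - x - x ^ 2 ≤ (1 - x - F₂) * (1 - x ^ 2) := by
      have e : (1 - x - F₂) * (1 - x ^ 2) = (1 - x - x ^ 2) + (x ^ 3 - F₂ * (1 - x ^ 2)) := by ring
      rw [e]
      linarith
    have h0pos : 0 ≤ 2 * x * (1 - 3 * x ^ 2) := mul_nonneg (by positivity) (by linarith)
    have hprod : 2 * x * (1 - 3 * x ^ 2) * (1 - x - x ^ 2) ≤
        (2 * x * (1 - x ^ 2) - (2 + 2 * x ^ 2) * E₂) * (1 - x ^ 2) * ((1 - x - F₂) * (1 - x ^ 2)) :=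
      mul_le_mul h0 hb (by linarith) (h0pos.trans h0)
    have hEF : E₂ * (1 - x ^ 2) * (F₂ * (1 - x ^ 2)) ≤ x ^ 3 * x ^ 3 :=
      mul_le_mul hE₂b hF₂b (mul_nonneg hF₂ h1x2.le) (pow_nonneg hx0 3)
    have hEFS : E₂ * (1 - x ^ 2) * (F₂ * (1 - x ^ 2)) * ((1 + x) + (1 - x) ^ 3) ≤
        x ^ 3 * x ^ 3 * 2 :=
      mul_le_mul hEF hS2 hS0 (by positivity)
    have hx6 : x ^ 3 * x ^ 3 ≤ 1 / 8 * (1 / 8) :=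
      mul_le_mul hx3 hx3 (pow_nonneg hx0 3) (by norm_num)
    have h16 : 1 / 4 * (1 / 4) ≤ (1 - 3 * x ^ 2) * (1 - x - x ^ 2) :=
      mul_le_mul (by linarith) (by linarith) (by norm_num) (by linarith)
    have hpoly : x ^ 3 * x ^ 3 * 2 ≤ (1 - 3 * x ^ 2) * (1 - x - x ^ 2) := by linarith
    have key : (1 - x ^ 2) ^ 2 * ((2 * x * (1 - x ^ 2) - (2 + 2 * x ^ 2) * E₂) * (1 - x - F₂) -
        2 * x * E₂ * F₂ * ((1 + x) + (1 - x) ^ 3)) =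
        (2 * x * (1 - x ^ 2) - (2 + 2 * x ^ 2) * E₂) * (1 - x ^ 2) * ((1 - x - F₂) * (1 - x ^ 2)) -
          2 * x * (E₂ * (1 - x ^ 2) * (F₂ * (1 - x ^ 2)) * ((1 + x) + (1 - x) ^ 3)) := by
      ring
    have h2 : 0 ≤ (1 - x ^ 2) ^ 2 * ((2 * x * (1 - x ^ 2) - (2 + 2 * x ^ 2) * E₂) * (1 - x - F₂) -
        2 * x * E₂ * F₂ * ((1 + x) + (1 - x) ^ 3)) := by
      rw [key]
      have h2x : (0 : ℝ) ≤ 2 * x := by positivity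
      linarith [mul_le_mul_of_nonneg_left hEFS h2x, mul_le_mul_of_nonneg_left hpoly h2x]
    exact (mul_nonneg_iff_of_pos_left (pow_pos h1x2 2)).mp h2
  -- the `E₁` coefficient `K₁ = k b'₂ P - 2x E₂ F₂ S`, `k = 2(1-x²) - 2xE₂ ≥ 4/3`
  have hK1 : 0 ≤ (2 * (1 - x ^ 2) - 2 * x * E₂) * (1 - x - F₂) * (1 + x) -
      2 * x * E₂ * F₂ * ((1 + x) + (1 - x) ^ 3) := by
    have hxE : x * E₂ ≤ 1 / 2 * (1 / 6) := mul_le_mul hx hE₂' hE₂ (by norm_num)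
    have hk : 4 / 3 ≤ 2 * (1 - x ^ 2) - 2 * x * E₂ := by linarith
    have t1 : 4 / 3 * (1 / 3) ≤ (2 * (1 - x ^ 2) - 2 * x * E₂) * (1 - x - F₂) :=
      mul_le_mul hk (by linarith) (by norm_num) (by linarith)
    have t2 : 4 / 3 * (1 / 3) * 1 ≤ (2 * (1 - x ^ 2) - 2 * x * E₂) * (1 - x - F₂) * (1 + x) :=
      mul_le_mul t1 (by linarith) (by norm_num) (le_trans (by norm_num) t1)
    have hxEF : x * E₂ * F₂ ≤ 1 / 2 * (1 / 6) * (1 / 6) := mul_le_mul hxE hF₂' hF₂ (by norm_num)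
    have t3 : x * E₂ * F₂ * ((1 + x) + (1 - x) ^ 3) ≤ 1 / 2 * (1 / 6) * (1 / 6) * 2 :=
      mul_le_mul hxEF hS2 hS0 (by norm_num)
    linarith
  -- assembly: difference `= (1+x)·G₀ + E₁·K₁`
  have key : ((1 + x + E₁) * (1 - x - E₂) * (1 + x) - (1 - x - E₁) * (1 + x + E₂) * (1 - x)) *
        (1 - x - F₂) * (1 + x) - 2 * x * E₂ * F₂ * (1 + x + E₁) * ((1 + x) + (1 - x) ^ 3) =
      (1 + x) * ((2 * x * (1 - x ^ 2) - (2 + 2 * x ^ 2) * E₂) * (1 - x - F₂) -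
          2 * x * E₂ * F₂ * ((1 + x) + (1 - x) ^ 3)) +
        E₁ * ((2 * (1 - x ^ 2) - 2 * x * E₂) * (1 - x - F₂) * (1 + x) -
          2 * x * E₂ * F₂ * ((1 + x) + (1 - x) ^ 3)) := by
    ring
  have hP : 0 ≤ 1 + x := by linarith
  linarith [mul_nonneg hP hG0, mul_nonneg hE₁ hK1, key]

/-- **Residual inequality.** With `T₁ = a₁a'₂P^{u+1} - a'₁a₂M^{u+1}`,
`T₂ = b₃b'₂P^{m+1} + b'₃b₂M^{m+1}` (notation of the file header):
`2x E₂ F₂ (a₁ b₃ P^{u+m+1} + a'₁ b'₃ M^{u+m+1}) ≤ T₁ T₂` for `0 ≤ x ≤ 1/2` and admissible `E`'s.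
Chain: `T₁ ≥ P^u h` (`M^u ≤ P^u`), `T₂ ≥ b₃ b'₂ P^{m+1} ≥ 0`, `a'₁ b'₃ M^{u+m+1} ≤ a₁ b₃ M³ P^{u+m}`
(`a' ≤ M a`, `b' ≤ M b`), then `overNest_core` times `P^{u+m} b₃`. [folklore] -/
private theorem overNest_bracket {x E₁ E₂ F₂ F₃ : ℝ} (u m : ℕ) (hx0 : 0 ≤ x) (hx : x ≤ 1 / 2)
    (hE₁ : 0 ≤ E₁) (hE₁' : E₁ ≤ 1 / 6) (hE₂ : 0 ≤ E₂) (hE₂b : E₂ * (1 - x ^ 2) ≤ x ^ 3)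
    (hF₂ : 0 ≤ F₂) (hF₂b : F₂ * (1 - x ^ 2) ≤ x ^ 3) (hF₃ : 0 ≤ F₃) (hF₃' : F₃ ≤ 1 / 6) :
    2 * x * E₂ * F₂ * ((1 + x + E₁) * (1 + x + F₃) * (1 + x) ^ (u + m + 1) +
        (1 - x - E₁) * (1 - x - F₃) * (1 - x) ^ (u + m + 1)) ≤
      ((1 + x + E₁) * (1 - x - E₂) * (1 + x) ^ (u + 1) -
          (1 - x - E₁) * (1 + x + E₂) * (1 - x) ^ (u + 1)) *
        ((1 + x + F₃) * (1 - x - F₂) * (1 + x) ^ (m + 1) +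
          (1 - x - F₃) * (1 + x + F₂) * (1 - x) ^ (m + 1)) := by
  have hF₂' : F₂ ≤ 1 / 6 := overNest_le_sixth hx0 hx hF₂ hF₂b
  have hM : 0 ≤ 1 - x := by linarith
  have hP : 0 ≤ 1 + x := by linarith
  have ha₁ : 0 ≤ 1 - x - E₁ := by linarith
  have hb₃ : 0 ≤ 1 - x - F₃ := by linarith
  have hMP : ∀ n : ℕ, (1 - x) ^ n ≤ (1 + x) ^ n := fun n => pow_le_pow_left₀ hM (by linarith) n
  have hcore := overNest_core hx0 hx hE₁ hE₂ hF₂ hE₂b hF₂b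
  -- `h ≥ 0` (from the core inequality, its left side being `≥ 0` and `b'₂ P > 0`)
  have hh : 0 ≤ (1 + x + E₁) * (1 - x - E₂) * (1 + x) - (1 - x - E₁) * (1 + x + E₂) * (1 - x) := by
    have hS0 : 0 ≤ (1 + x) + (1 - x) ^ 3 := by
      have := pow_nonneg hM 3
      linarith
    have hL : 0 ≤ 2 * x * E₂ * F₂ * (1 + x + E₁) * ((1 + x) + (1 - x) ^ 3) :=
      mul_nonneg (mul_nonneg (by positivity) (by linarith)) hS0
    have hpos : 0 < (1 - x - F₂) * (1 + x) := mul_pos (by linarith) (by linarith)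
    refine le_of_mul_le_mul_right ?_ hpos
    rw [zero_mul, ← mul_assoc]
    exact hL.trans hcore
  -- `T₁ ≥ P^u h ≥ 0`
  have hT1 : (1 + x) ^ u *
        ((1 + x + E₁) * (1 - x - E₂) * (1 + x) - (1 - x - E₁) * (1 + x + E₂) * (1 - x)) ≤
      (1 + x + E₁) * (1 - x - E₂) * (1 + x) ^ (u + 1) -
        (1 - x - E₁) * (1 + x + E₂) * (1 - x) ^ (u + 1) := by
    have e : (1 + x + E₁) * (1 - x - E₂) * (1 + x) ^ (u + 1) -
          (1 - x - E₁) * (1 + x + E₂) * (1 - x) ^ (u + 1) -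
        (1 + x) ^ u *
          ((1 + x + E₁) * (1 - x - E₂) * (1 + x) - (1 - x - E₁) * (1 + x + E₂) * (1 - x)) =
        (1 - x - E₁) * (1 + x + E₂) * (1 - x) * ((1 + x) ^ u - (1 - x) ^ u) := by
      ring
    have : 0 ≤ (1 - x - E₁) * (1 + x + E₂) * (1 - x) * ((1 + x) ^ u - (1 - x) ^ u) :=
      mul_nonneg (mul_nonneg (mul_nonneg ha₁ (by linarith)) hM) (sub_nonneg.2 (hMP u))
    linarith
  -- `T₂ ≥ b₃ b'₂ P^{m+1} ≥ 0`
  have hT2 : (1 + x + F₃) * (1 - x - F₂) * (1 + x) ^ (m + 1) ≤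
      (1 + x + F₃) * (1 - x - F₂) * (1 + x) ^ (m + 1) +
        (1 - x - F₃) * (1 + x + F₂) * (1 - x) ^ (m + 1) := by
    have : 0 ≤ (1 - x - F₃) * (1 + x + F₂) * (1 - x) ^ (m + 1) :=
      mul_nonneg (mul_nonneg hb₃ (by linarith)) (pow_nonneg hM _)
    linarith
  -- `a'₁ b'₃ M^{u+m+1} ≤ a₁ b₃ M³ P^{u+m}`
  have hR1 : (1 - x - E₁) * (1 - x - F₃) * (1 - x) ^ (u + m + 1) ≤
      (1 + x + E₁) * (1 + x + F₃) * ((1 - x) ^ 3 * (1 + x) ^ (u + m)) := by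
    have h1 : 1 - x - E₁ ≤ (1 - x) * (1 + x + E₁) := by
      linarith [mul_nonneg hM (add_nonneg hx0 hE₁)]
    have h2 : 1 - x - F₃ ≤ (1 - x) * (1 + x + F₃) := by
      linarith [mul_nonneg hM (add_nonneg hx0 hF₃)]
    have h3 : (1 - x) ^ (u + m + 1) ≤ (1 - x) * (1 + x) ^ (u + m) := by
      rw [pow_succ, mul_comm]
      exact mul_le_mul_of_nonneg_left (hMP (u + m)) hM
    calc (1 - x - E₁) * (1 - x - F₃) * (1 - x) ^ (u + m + 1)
        ≤ (1 - x) * (1 + x + E₁) * ((1 - x) * (1 + x + F₃)) * ((1 - x) * (1 + x) ^ (u + m)) :=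
          mul_le_mul (mul_le_mul h1 h2 hb₃ (mul_nonneg hM (by linarith))) h3 (pow_nonneg hM _)
            (mul_nonneg (mul_nonneg hM (by linarith)) (mul_nonneg hM (by linarith)))
      _ = (1 + x + E₁) * (1 + x + F₃) * ((1 - x) ^ 3 * (1 + x) ^ (u + m)) := by ring
  -- the chain
  calc 2 * x * E₂ * F₂ * ((1 + x + E₁) * (1 + x + F₃) * (1 + x) ^ (u + m + 1) +
        (1 - x - E₁) * (1 - x - F₃) * (1 - x) ^ (u + m + 1))
      ≤ 2 * x * E₂ * F₂ * ((1 + x + E₁) * (1 + x + F₃) * (1 + x) ^ (u + m + 1) +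
          (1 + x + E₁) * (1 + x + F₃) * ((1 - x) ^ 3 * (1 + x) ^ (u + m))) :=
        mul_le_mul_of_nonneg_left (by linarith) (by positivity)
    _ = (1 + x) ^ (u + m) * (1 + x + F₃) *
          (2 * x * E₂ * F₂ * (1 + x + E₁) * ((1 + x) + (1 - x) ^ 3)) := by ring
    _ ≤ (1 + x) ^ (u + m) * (1 + x + F₃) *
          (((1 + x + E₁) * (1 - x - E₂) * (1 + x) - (1 - x - E₁) * (1 + x + E₂) * (1 - x)) *
            (1 - x - F₂) * (1 + x)) :=
        mul_le_mul_of_nonneg_left hcore (mul_nonneg (pow_nonneg hP _) (by linarith))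
    _ = (1 + x) ^ u *
          ((1 + x + E₁) * (1 - x - E₂) * (1 + x) - (1 - x - E₁) * (1 + x + E₂) * (1 - x)) *
        ((1 + x + F₃) * (1 - x - F₂) * (1 + x) ^ (m + 1)) := by ring
    _ ≤ _ :=
        mul_le_mul hT1 hT2 (mul_nonneg (mul_nonneg (by linarith) (by linarith)) (pow_nonneg hP _))
          ((mul_nonneg (pow_nonneg hP u) hh).trans hT1)

/-- **The real inequality behind the stub** (rank-two forms, notation of the file header):
`S₁₃ · R ≤ X · S₂₃`, from the exact residual identity
`4PM (X S₂₃ - S₁₃ R) = x^{u+m+2} (T₁ T₂ - 2x E₂ F₂ (a₁ b₃ P^{u+m+1} + a'₁ b'₃ M^{u+m+1}))` (`ring`)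
and `overNest_bracket`. [folklore] -/
private theorem overNest_real {x E₁ E₂ F₂ F₃ : ℝ} (u m : ℕ) (hx0 : 0 ≤ x) (hx : x ≤ 1 / 2)
    (hE₁ : 0 ≤ E₁) (hE₁b : E₁ * (1 - x ^ 2) ≤ x ^ 3) (hE₂ : 0 ≤ E₂)
    (hE₂b : E₂ * (1 - x ^ 2) ≤ x ^ 3) (hF₂ : 0 ≤ F₂) (hF₂b : F₂ * (1 - x ^ 2) ≤ x ^ 3)
    (hF₃ : 0 ≤ F₃) (hF₃b : F₃ * (1 - x ^ 2) ≤ x ^ 3) :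
    x ^ (u + m + 1 + 1) / 2 *
          ((1 + x + E₁) * (1 + x + F₃) * (1 + x) ^ (u + m + 1) +
            (1 - x - E₁) * (1 - x - F₃) * (1 - x) ^ (u + m + 1)) *
        (x + E₂ + F₂) ≤
      x ^ (u + 1) / 2 *
          ((1 + x + E₁) * (1 + x + F₂) * (1 + x) ^ u - (1 - x - E₁) * (1 - x - F₂) * (1 - x) ^ u) *
        (x ^ (m + 1) / 2 *
          ((1 + x + E₂) * (1 + x + F₃) * (1 + x) ^ m +
            (1 - x - E₂) * (1 - x - F₃) * (1 - x) ^ m)) := by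
  have hB := overNest_bracket u m hx0 hx hE₁ (overNest_le_sixth hx0 hx hE₁ hE₁b) hE₂ hE₂b hF₂ hF₂b
    hF₃ (overNest_le_sixth hx0 hx hF₃ hF₃b)
  have hPM : 0 < 4 * (1 + x) * (1 - x) := mul_pos (mul_pos four_pos (by linarith)) (by linarith)
  rw [← sub_nonneg]
  have key : x ^ (u + 1) / 2 *
          ((1 + x + E₁) * (1 + x + F₂) * (1 + x) ^ u - (1 - x - E₁) * (1 - x - F₂) * (1 - x) ^ u) *
        (x ^ (m + 1) / 2 *
          ((1 + x + E₂) * (1 + x + F₃) * (1 + x) ^ m +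
            (1 - x - E₂) * (1 - x - F₃) * (1 - x) ^ m)) -
      x ^ (u + m + 1 + 1) / 2 *
          ((1 + x + E₁) * (1 + x + F₃) * (1 + x) ^ (u + m + 1) +
            (1 - x - E₁) * (1 - x - F₃) * (1 - x) ^ (u + m + 1)) *
        (x + E₂ + F₂) =
      x ^ (u + m + 1 + 1) *
        (((1 + x + E₁) * (1 - x - E₂) * (1 + x) ^ (u + 1) -
            (1 - x - E₁) * (1 + x + E₂) * (1 - x) ^ (u + 1)) *
          ((1 + x + F₃) * (1 - x - F₂) * (1 + x) ^ (m + 1) +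
            (1 - x - F₃) * (1 + x + F₂) * (1 - x) ^ (m + 1)) -
        2 * x * E₂ * F₂ * ((1 + x + E₁) * (1 + x + F₃) * (1 + x) ^ (u + m + 1) +
          (1 - x - E₁) * (1 - x - F₃) * (1 - x) ^ (u + m + 1))) / (4 * (1 + x) * (1 - x)) := by
    rw [eq_div_iff hPM.ne']
    ring
  rw [key]
  exact div_nonneg (mul_nonneg (pow_nonneg hx0 _) (sub_nonneg.2 hB)) hPM.le

/-- The same-row real form `x^n/2 · (a b P^k + a' b' M^k)` is `≥ 0` when `a', b' ≥ 0`,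
`0 ≤ x ≤ 1`, `E, F ≥ 0`. [folklore] -/
private theorem overNest_same_nonneg {x E F : ℝ} (n k : ℕ) (hx0 : 0 ≤ x) (hx1 : x ≤ 1)
    (hE : 0 ≤ E) (hF : 0 ≤ F) (ha : 0 ≤ 1 - x - E) (hb : 0 ≤ 1 - x - F) :
    0 ≤ x ^ n / 2 * ((1 + x + E) * (1 + x + F) * (1 + x) ^ k +
      (1 - x - E) * (1 - x - F) * (1 - x) ^ k) :=
  mul_nonneg (by positivity) (add_nonneg
    (mul_nonneg (mul_nonneg (by linarith) (by linarith)) (pow_nonneg (by linarith) k))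
    (mul_nonneg (mul_nonneg ha hb) (pow_nonneg (by linarith) k)))

/-- The opposite-row real form `x^n/2 · (a b P^k - a' b' M^k)` is `≥ 0` when `b' ≥ 0`,
`0 ≤ x ≤ 1`, `E, F ≥ 0` (`a' ≤ a`, `b' ≤ b`, `M^k ≤ P^k`). [folklore] -/
private theorem overNest_cross_nonneg {x E F : ℝ} (n k : ℕ) (hx0 : 0 ≤ x) (hx1 : x ≤ 1)
    (hE : 0 ≤ E) (hF : 0 ≤ F) (hb : 0 ≤ 1 - x - F) :
    0 ≤ x ^ n / 2 * ((1 + x + E) * (1 + x + F) * (1 + x) ^ k -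
      (1 - x - E) * (1 - x - F) * (1 - x) ^ k) := by
  refine mul_nonneg (by positivity) (sub_nonneg.2 ?_)
  exact mul_le_mul (mul_le_mul (by linarith) (by linarith) hb (by linarith))
    (pow_le_pow_left₀ (by linarith) (by linarith) k) (pow_nonneg (by linarith) k)
    (mul_nonneg (by linarith) (by linarith))

/-! ## The ladder kernels in rank-two form -/

/-- Same-row (bottom) kernels of the ladder `{0..L}×{0,1}` in rank-two form: for
`i + m + 1 = j ≤ L` and `x ≥ 0`,
`Z_{R_L}((i,0),(j,0)) = x^{m+1}/2 · [(1+x+E_i)(1+x+E_{L-j}) P^m + (1-x-E_i)(1-x-E_{L-j}) M^m]`,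
`P = 1+x`, `M = 1-x` (`stub_ladderKernels_interior` with `ε = +1`, regrouped by `ring`).
[folklore] -/
private theorem overNest_kernel_same (L i j m : ℕ) (hm : i + m + 1 = j) (hjL : j ≤ L) {x : ℝ}
    (hx : 0 ≤ x) :
    pathKernel (discreteDomainGraph (rectDomain L 1) 1) x (st i 0) (st j 0) =
      ENNReal.ofReal (x ^ (m + 1) / 2 *
        ((1 + x + ∑ d ∈ Finset.range i, x ^ (2 * d + 3)) *
              (1 + x + ∑ d ∈ Finset.range (L - j), x ^ (2 * d + 3)) * (1 + x) ^ m +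
          (1 - x - ∑ d ∈ Finset.range i, x ^ (2 * d + 3)) *
              (1 - x - ∑ d ∈ Finset.range (L - j), x ^ (2 * d + 3)) * (1 - x) ^ m)) := by
  -- adapted from `rungAdj_kernel_same` (LadderBbbtRungAdjacent)
  rw [stub_ladderKernels_interior L i j (by omega) hjL hx 0 0 (Or.inl rfl) (Or.inl rfl), if_pos rfl]
  congr 1
  subst hm
  have e1 : i + m + 1 - i = m + 1 := by omega
  have e2 : m + 1 - 1 = m := rfl
  rw [e1, e2]
  ring

/-- Opposite-row kernels of the ladder `{0..L}×{0,1}` in rank-two form: for `i + m + 1 = j ≤ L`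
and `x ≥ 0`,
`Z_{R_L}((i,0),(j,1)) = x^{m+1}/2 · [(1+x+E_i)(1+x+E_{L-j}) P^m - (1-x-E_i)(1-x-E_{L-j}) M^m]`
(`stub_ladderKernels_interior` with `ε = -1`, regrouped by `ring`). [folklore] -/
private theorem overNest_kernel_cross (L i j m : ℕ) (hm : i + m + 1 = j) (hjL : j ≤ L) {x : ℝ}
    (hx : 0 ≤ x) :
    pathKernel (discreteDomainGraph (rectDomain L 1) 1) x (st i 0) (st j 1) =
      ENNReal.ofReal (x ^ (m + 1) / 2 *
        ((1 + x + ∑ d ∈ Finset.range i, x ^ (2 * d + 3)) *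
              (1 + x + ∑ d ∈ Finset.range (L - j), x ^ (2 * d + 3)) * (1 + x) ^ m -
          (1 - x - ∑ d ∈ Finset.range i, x ^ (2 * d + 3)) *
              (1 - x - ∑ d ∈ Finset.range (L - j), x ^ (2 * d + 3)) * (1 - x) ^ m)) := by
  -- adapted from `rungAdj_kernel_cross` (LadderBbbtRungAdjacent)
  rw [stub_ladderKernels_interior L i j (by omega) hjL hx 0 1 (Or.inl rfl) (Or.inr rfl),
    if_neg (by norm_num)]
  congr 1
  subst hm
  have e1 : i + m + 1 - i = m + 1 := by omega
  have e2 : m + 1 - 1 = m := rfl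
  rw [e1, e2]
  ring

/-! ## The stub -/

/-- **Tool stub `stub_ladder_bbbt_over_nested`.** On the ladder `{0..L}×{0,1}`, for three bottom
sites `c₁ < c₂ < c₃ ≤ L` and the top site `(c₂,1)` above the middle one (cyclic order
`(c₁,0),(c₂,0),(c₃,0),(c₂,1)`) and `0 ≤ x ≤ 1/2`, the crossing pairing weighs at most the nested
one: `Z((c₁,0),(c₃,0)) Z((c₂,0),(c₂,1)) ≤ Z((c₁,0),(c₂,1)) Z((c₂,0),(c₃,0))`. Mechanism: in the
rank-two form of the ladder kernels the difference is a Cauchy–Binet product of two signed cross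
products minus the rung defect `δ = x E_{c₂} E_{L-c₂}/(1-x²)` times `Z((c₁,0),(c₃,0))`; the defect
is dominated with a factor to spare (`overNest_core`: `(1-3x²)(1-x-x²) ≥ 2x⁶` on `[0,1/2]`).
[folklore] -/
theorem stub_ladder_bbbt_over_nested (L : ℕ) {c₁ c₂ c₃ : ℕ} (h₁₂ : c₁ < c₂) (h₂₃ : c₂ < c₃)
    (h₃ : c₃ ≤ L) {x : ℝ} (hx0 : 0 ≤ x) (hx : x ≤ 1 / 2) :
    pathKernel (discreteDomainGraph (rectDomain L 1) 1) x (st c₁ 0) (st c₃ 0) *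
        pathKernel (discreteDomainGraph (rectDomain L 1) 1) x (st c₂ 0) (st c₂ 1) ≤
      pathKernel (discreteDomainGraph (rectDomain L 1) 1) x (st c₁ 0) (st c₂ 1) *
        pathKernel (discreteDomainGraph (rectDomain L 1) 1) x (st c₂ 0) (st c₃ 0) := by
  obtain ⟨u, hu⟩ : ∃ u, c₁ + u + 1 = c₂ := ⟨c₂ - c₁ - 1, by omega⟩
  obtain ⟨m, hm⟩ : ∃ m, c₂ + m + 1 = c₃ := ⟨c₃ - c₂ - 1, by omega⟩
  have hE : ∀ k : ℕ, 0 ≤ ∑ d ∈ Finset.range k, x ^ (2 * d + 3) := overNest_E_nonneg hx0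
  have hEb : ∀ k : ℕ, (∑ d ∈ Finset.range k, x ^ (2 * d + 3)) * (1 - x ^ 2) ≤ x ^ 3 :=
    overNest_E_bound hx0
  have ha : ∀ k : ℕ, 0 ≤ 1 - x - ∑ d ∈ Finset.range k, x ^ (2 * d + 3) := fun k => by
    linarith [overNest_le_sixth hx0 hx (hE k) (hEb k)]
  rw [overNest_kernel_same L c₁ c₃ (u + m + 1) (by omega) h₃ hx0,
    stub_ladderRung L c₂ (by omega) hx0,
    overNest_kernel_cross L c₁ c₂ u hu (by omega) hx0, overNest_kernel_same L c₂ c₃ m hm h₃ hx0,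
    ← ENNReal.ofReal_mul
      (overNest_same_nonneg (u + m + 1 + 1) (u + m + 1) hx0 (by linarith) (hE c₁) (hE (L - c₃))
        (ha c₁) (ha (L - c₃))),
    ← ENNReal.ofReal_mul
      (overNest_cross_nonneg (u + 1) u hx0 (by linarith) (hE c₁) (hE (L - c₂)) (ha (L - c₂)))]
  exact ENNReal.ofReal_le_ofReal (overNest_real u m hx0 hx (hE c₁) (hEb c₁) (hE c₂) (hEb c₂)
    (hE (L - c₂)) (hEb (L - c₂)) (hE (L - c₃)) (hEb (L - c₃)))

end Summit.CriticalPhenomena.SAWScalingLimit.Theorems.BoundaryTP2
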